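import Summits.CriticalPhenomena.CardyFormulaZ2.Theorems.CardyMagicRigidityNestingRigidityNeckZ2NodeAnnuli
import HarnessLib

/-!
# Crux `NestingRigidity`, line `pinch-resampling` (v4), stub S12: the arms of a necklace skeleton

Crux `Summit.CriticalPhenomena.CardyFormulaZ2.Theses.CardyMagicRigidity.NestingRigidity`
(stmt-CriticalPhenomena-4835), line `pinch-resampling` v4, stub S12 `stub_neckHookupCoarseZ2 : NeckHookupCoarseZ2`.
Brick of the summation of the necklace bound `ZNodeAbsBoundChainA` (amended plan in the module docstring of
`…NestingRigidityGapEntropy`, worker W6a): the ARM side of the hypotheses of the glued bound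
`real_fourArm_and_armsIn_le` (`…NeckZ2NodeReimerRegion`) for a necklace `N` (`…NeckZ2Necklace`) with a compatible
cell skeleton `S` (`…NeckZ2SkeletonCells`, `…NeckZ2NodeAnnuli`).

* §1 **Arm cells** (`exists_armCells`): there is a set `A` of occupied cells, `2 |A| ≥ n`, and representatives
  `a m < k` of rotated cell `t m`, whose big clusters `bigIdx (a m)` are pairwise distinct on `A` (a big cluster
  passes through at most two locales, `Necklace.bigIdx_eq_bigIdx`; a map with fibres of size `≤ 2` is injective on a
  half-size subset, `exists_half_injOn`).
* §2 **Arm annuli**: slot `z` around the cell `m` is `zAnn (nodeCenter m) (R₀ 2^{K z}) (R₀ 2^{K (z+1)} - 1)`;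
  `Necklace.arm_harm`: the representative locale starts an arm across it inside `Λ_{2s}(x)` as soon as `ℓ ≤ R₀` and
  `2 (R₀ 2^{K(z+1)} - 1) ≤ lam`; `armAnnulus_disjoint`: different slots of one cell have disjoint annuli;
  `Necklace.arm_hdist`: arms at cells of `A` with distinct indices start in distinct clusters — the pairwise
  hypothesis of the glue.
* §3 **Exemption from the nodes** (`Necklace.arm_havoid`, registered anchor `necklace_arm_exemption`): given the
  crossing clusters `u i₁`, `u (j₁ + 1)` of a node certificate, an arm whose big cluster index is neither `i₁` nor
  `j₁ + 1` is cluster-exempt (`Necklace.not_path_p_of_bigIdx_ne`); so if the CLAIMED slots of a cell avoid (are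
  spatially disjoint from) the annuli of the nodes IN CONFLICT with it (`bigIdx (a m) ∈ {i₁, j₁ + 1}`), the
  alternative `havoid` of the glue holds for every claimed slot and every certified node.

What is NOT here (next bricks): the count of the slots blocked by a conflicting node (`≤ log₂(band ratio)/K + 2`,
band ratio `≤ ρ_Q/8 + 3`), the double count `Σ_m #conflicts(m) ≤ 2 #good`, and the probabilistic assembly.
-/

noncomputable section

namespace Summit.CriticalPhenomena.CardyFormulaZ2.Cruxes.NestingRigidity.PinchResampling

open MeasureTheory Set Literature.Probability.Percolation Literature.Probability.LatticeModels
open ZPinchLocality Finset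
open NeckCoarseZ2

/-! ## §1 Arm cells -/

/-- **A map with fibres of size at most two is injective on a subset of at least half the size.** -/
theorem exists_half_injOn {α β : Type*} [Inhabited α] [DecidableEq α] [DecidableEq β] (s : Finset α) (f : α → β)
    (h2 : ∀ x ∈ s, ∀ y ∈ s, ∀ z ∈ s, f x = f y → f y = f z → x = y ∨ y = z ∨ x = z) :
    ∃ A ⊆ s, s.card ≤ 2 * A.card ∧ Set.InjOn f ↑A := by
  classical
  -- a section of `f` over its image
  set g : β → α := Function.invFunOn f ↑s with hgdef
  have hsec : ∀ b ∈ s.image f, g b ∈ s ∧ f (g b) = b := fun b hb ↦ by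
    obtain ⟨a, ha, hab⟩ := Finset.mem_image.1 hb
    have hex : ∃ a ∈ (↑s : Set α), f a = b := ⟨a, ha, hab⟩
    exact ⟨Function.invFunOn_mem hex, Function.invFunOn_eq hex⟩
  refine ⟨(s.image f).image g, fun a ha ↦ ?_, ?_, ?_⟩
  · obtain ⟨b, hb, rfl⟩ := Finset.mem_image.1 ha
    exact (hsec b hb).1
  · -- `|s| = Σ_b |fibre b| ≤ 2 |image| = 2 |A|`
    have hginj : Set.InjOn g ↑(s.image f) := fun b hb b' hb' hbb ↦ by
      rw [← (hsec b hb).2, ← (hsec b' hb').2, hbb]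
    rw [card_image_of_injOn hginj, card_eq_sum_card_fiberwise (f := f) (t := s.image f)
      fun a ha ↦ mem_image_of_mem f ha, card_eq_sum_ones (s.image f), mul_sum]
    refine sum_le_sum fun b _ ↦ ?_
    rw [mul_one]
    -- a fibre has at most two elements
    by_contra hcon
    obtain ⟨x, hx, y, hy, z, hz, hxy, hxz, hyz⟩ := two_lt_card.1 (lt_of_not_ge hcon)
    simp only [mem_filter] at hx hy hz
    rcases h2 x hx.1 y hy.1 z hz.1 (hx.2.trans hy.2.symm) (hy.2.trans hz.2.symm) with h | h | h
    · exact hxy h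
    · exact hyz h
    · exact hxz h
  · intro a ha a' ha' hfa
    obtain ⟨b, hb, rfl⟩ := Finset.mem_image.1 (mem_coe.1 ha)
    obtain ⟨b', hb', rfl⟩ := Finset.mem_image.1 (mem_coe.1 ha')
    rw [(hsec b hb).2, (hsec b' hb').2] at hfa
    rw [hfa]

namespace Necklace

variable {ω : BondConfig (Site 2)} {ℓ lam s : ℕ} {x : Site 2} (N : Necklace ω ℓ lam s x) {Nc : ℤ}
  (S : CellSkeleton Nc)

/-- **Arm cells and representatives**: for a cell skeleton compatible with the necklace there are representatives
`a m < k` of the rotated cells `t m` (`m < n`) and a set `A ⊆ [0, n)` of cells with `n ≤ 2 |A|` on which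
`m ↦ bigIdx (a m)` is injective. -/
theorem exists_armCells
    (hcomp' : ∀ m < S.n, ∃ a < N.k, rotIdx Nc S.a₀ (cellIdx ((s : ℤ) + 1) ℓ (N.p a - x)) = S.t m) :
    ∃ (a : ℕ → ℕ) (A : Finset ℕ), (∀ m < S.n, a m < N.k ∧ rotIdx Nc S.a₀ (cellIdx ((s : ℤ) + 1) ℓ (N.p (a m) - x)) = S.t m) ∧
      A ⊆ range S.n ∧ S.n ≤ 2 * A.card ∧ Set.InjOn (fun m ↦ N.bigIdx (a m)) ↑A := by
  classical
  choose! a ha hat using hcomp'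
  -- distinct cells have distinct representatives
  have hainj : ∀ m < S.n, ∀ m' < S.n, a m = a m' → m = m' := fun m hm m' hm' h ↦ by
    have h1 := hat m hm
    rw [h, hat m' hm'] at h1
    by_contra hne
    rcases lt_or_gt_of_ne hne with hlt | hlt
    · exact absurd (S.t_strictMono hlt hm') (by rw [h1]; exact lt_irrefl _)
    · exact absurd (S.t_strictMono hlt hm) (by rw [h1]; exact lt_irrefl _)
  obtain ⟨A, hA, hcard, hinj⟩ := exists_half_injOn (range S.n) (fun m ↦ N.bigIdx (a m))
    (fun m hm m' hm' m'' hm'' h h' ↦ by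
      rw [Finset.mem_range] at hm hm' hm''
      -- three cells sharing a big cluster: impossible
      rcases N.bigIdx_eq_bigIdx h with e | e
      · exact Or.inl (hainj _ hm _ hm' e)
      rcases N.bigIdx_eq_bigIdx h' with e' | e'
      · exact Or.inr (Or.inl (hainj _ hm' _ hm'' e'))
      rcases N.bigIdx_eq_bigIdx (h.trans h') with e'' | e''
      · exact Or.inr (Or.inr (hainj _ hm _ hm'' e''))
      exfalso
      rcases e with e | e <;> rcases e' with e' | e' <;> rcases e'' with e'' | e'' <;> omega)
  exact ⟨a, A, fun m hm ↦ ⟨ha m hm, hat m hm⟩, hA, by rwa [card_range] at hcard, hinj⟩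

/-! ## §2 Arm annuli -/

/-- **Inner radius of the arm slot `z`**: `R₀ 2^{K z}`. -/
def armRIn (R₀ K z : ℕ) : ℕ := R₀ * 2 ^ (K * z)

/-- **Outer radius of the arm slot `z`**: `R₀ 2^{K (z + 1)} - 1`. -/
def armROut (R₀ K z : ℕ) : ℕ := R₀ * 2 ^ (K * (z + 1)) - 1

omit N S in
/-- The radii of a slot: `1 ≤ rIn`, `rIn + 1 ≤ ROut` (`R₀ ≥ 2`, `K ≥ 1`). -/
theorem armRIn_le {R₀ K : ℕ} (hR₀ : 2 ≤ R₀) (hK : 1 ≤ K) (z : ℕ) :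
    1 ≤ armRIn R₀ K z ∧ armRIn R₀ K z + 1 ≤ armROut R₀ K z := by
  have h1 : 1 ≤ 2 ^ (K * z) := Nat.one_le_two_pow
  have h2 : 2 ^ (K * z) * 2 ≤ 2 ^ (K * (z + 1)) := by
    rw [← pow_succ]
    exact Nat.pow_le_pow_right (by norm_num) (by nlinarith)
  have hA : 2 ≤ R₀ * 2 ^ (K * z) := by nlinarith
  have hB : R₀ * 2 ^ (K * z) * 2 ≤ R₀ * 2 ^ (K * (z + 1)) := by nlinarith
  simp only [armRIn, armROut]
  generalize R₀ * 2 ^ (K * z) = P at hA hB ⊢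
  generalize R₀ * 2 ^ (K * (z + 1)) = Q at hB ⊢
  constructor <;> omega

omit N S in
/-- **Different slots of one centre have disjoint annuli.** -/
theorem armAnnulus_disjoint {R₀ K : ℕ} (hR₀ : 2 ≤ R₀) (w : Site 2) {z z' : ℕ} (hzz : z ≠ z') :
    Disjoint (zAnn w (armRIn R₀ K z) (armROut R₀ K z)) (zAnn w (armRIn R₀ K z') (armROut R₀ K z')) := by
  -- the slot with the smaller index ends before the other begins
  wlog hlt : z < z' generalizing z z'
  · exact (this hzz.symm (lt_of_le_of_ne (not_lt.1 hlt) hzz.symm)).symm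
  have hmono : armROut R₀ K z < armRIn R₀ K z' := by
    have h1 : 2 ^ (K * (z + 1)) ≤ 2 ^ (K * z') := Nat.pow_le_pow_right (by norm_num) (by nlinarith)
    have h2 : 1 ≤ R₀ * 2 ^ (K * (z + 1)) := by nlinarith [Nat.one_le_two_pow (n := K * (z + 1))]
    have h3 : R₀ * 2 ^ (K * (z + 1)) ≤ R₀ * 2 ^ (K * z') := Nat.mul_le_mul_left _ h1
    simp only [armRIn, armROut]
    generalize R₀ * 2 ^ (K * (z + 1)) = P at h2 h3 ⊢
    generalize R₀ * 2 ^ (K * z') = Q at h3 ⊢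
    omega
  rw [Set.disjoint_left]
  rintro y ⟨-, hy⟩ ⟨hy', -⟩
  have : (armROut R₀ K z : ℤ) < armRIn R₀ K z' := by exact_mod_cast hmono
  omega

/-- **The arm hypothesis `harm` of the glue**: the representative locale of the cell `m` (rotated cell `t m`) starts
an arm across every slot around `nodeCenter m` with `ℓ ≤ R₀` and `2 · armROut ≤ lam`. -/
theorem arm_harm (hℓ : 1 ≤ ℓ) (hNc : 8 * ((s : ℤ) + 1) ≤ Nc * ℓ) (hNc' : (Nc - 1) * (ℓ : ℤ) < 8 * ((s : ℤ) + 1))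
    {a m : ℕ} (ha : a < N.k) (hm : m < S.n)
    (hat : rotIdx Nc S.a₀ (cellIdx ((s : ℤ) + 1) ℓ (N.p a - x)) = S.t m) {R₀ K z : ℕ} (hR₀ : ℓ ≤ R₀)
    (hlam : 2 * armROut R₀ K z ≤ lam) :
    zNorm (N.p a - S.nodeCenter ((s : ℤ) + 1) ℓ x m) < armRIn R₀ K z ∧
      ∃ q, (armROut R₀ K z : ℤ) ≤ zNorm (q - S.nodeCenter ((s : ℤ) + 1) ℓ x m) ∧
        PathIn (openGraph ω) (zBall x (2 * s)) (N.p a) q := by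
  have hℓ0 : (0 : ℤ) < ℓ := by exact_mod_cast hℓ
  refine N.arm_hypothesis ha ?_ hlam
  have h := S.zNorm_sub_center_lt hℓ0 (by omega) hNc hNc' (N.zNorm_p_sub ha) le_rfl le_rfl hm hat
  simp only [sub_self, zero_add, one_mul] at h
  simp only [CellSkeleton.nodeCenter]
  rw [show N.p a - (x + idxPt ((s : ℤ) + 1) (ℓ : ℤ) Nc S.a₀ (S.t m)) =
    N.p a - x - idxPt ((s : ℤ) + 1) (ℓ : ℤ) Nc S.a₀ (S.t m) by abel]
  have h1 : (ℓ : ℤ) ≤ armRIn R₀ K z := by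
    have : R₀ ≤ armRIn R₀ K z := by
      simp only [armRIn]
      nlinarith [Nat.one_le_two_pow (n := K * z)]
    exact_mod_cast hR₀.trans this
  omega

/-- **The pairwise hypothesis `hdist` of the glue**: arms at two cells of `A` with distinct indices, or at one cell
with distinct slots, start in distinct clusters inside `Λ_{2s}(x)` or have disjoint annuli. -/
theorem arm_hdist {a : ℕ → ℕ} {A : Finset ℕ} (haA : ∀ m ∈ A, a m < N.k)
    (hinj : Set.InjOn (fun m ↦ N.bigIdx (a m)) ↑A) {R₀ K : ℕ} (hR₀ : 2 ≤ R₀) {m z m' z' : ℕ}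
    (hm : m ∈ A) (hm' : m' ∈ A) (hne : (m, z) ≠ (m', z')) :
    ¬ PathIn (openGraph ω) (zBall x (2 * s)) (N.p (a m)) (N.p (a m')) ∨
      Disjoint (zAnn (S.nodeCenter ((s : ℤ) + 1) ℓ x m) (armRIn R₀ K z) (armROut R₀ K z))
        (zAnn (S.nodeCenter ((s : ℤ) + 1) ℓ x m') (armRIn R₀ K z') (armROut R₀ K z')) := by
  by_cases hmm : m = m'
  · subst hmm
    right
    exact armAnnulus_disjoint hR₀ _ fun h ↦ hne (by rw [h])
  · left
    exact N.not_path_p_p (haA m hm) (haA m' hm') fun h ↦ hmm (hinj hm hm' h)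

/-! ## §3 Exemption from the nodes -/

/-- **The alternative `havoid` of the glue for one arm and one certified node**: if the big cluster of the arm's locale
is neither `u i₁` nor `u (j₁ + 1)` (the crossing clusters), the arm is cluster-exempt; otherwise (a CONFLICT) the
claimed slot must be spatially disjoint from the node annulus, which is the hypothesis `hfree`. -/
theorem arm_havoid {a₁ : ℕ} (ha₁ : a₁ < N.k) {i₁ j₁ : ℕ} (hi₁ : i₁ ≤ N.k) (hj₁ : j₁ + 1 ≤ N.k) {p₁ p₂ : Site 2}
    (hp₁ : PathIn (openGraph ω) (zBall x (2 * s)) (N.u i₁) p₁)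
    (hp₂ : PathIn (openGraph ω) (zBall x (2 * s)) (N.u (j₁ + 1)) p₂) {Arm Node : Set (Site 2)}
    (hfree : (N.bigIdx a₁ = i₁ ∨ N.bigIdx a₁ = j₁ + 1) → Disjoint Arm Node) :
    (¬ PathIn (openGraph ω) (zBall x (2 * s)) (N.p a₁) p₁ ∧ ¬ PathIn (openGraph ω) (zBall x (2 * s)) (N.p a₁) p₂) ∨
      Disjoint Arm Node := by
  by_cases hc : N.bigIdx a₁ = i₁ ∨ N.bigIdx a₁ = j₁ + 1
  · exact Or.inr (hfree hc)
  · rw [not_or] at hc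
    exact Or.inl (N.not_path_p_of_bigIdx_ne ha₁ hi₁ hj₁ hc.1 hc.2 hp₁ hp₂)

end Necklace

/-- **Cluster exemption of arms from certified nodes (registered helper, anchor of this module on the crux item)**:
an arm started at a locale whose big cluster is neither crossing cluster `u i₁`, `u (j₁ + 1)` of a node certificate is
joined inside `Λ_{2s}(x)` to neither crossing start; hence, if conflicts are resolved spatially (`hfree`), the
alternative `havoid` of `real_fourArm_and_armsIn_le` holds (`Necklace.arm_havoid`). -/
theorem necklace_arm_exemption : ∀ (ℓ lam s : ℕ) (x : Site 2) (ω : BondConfig (Site 2)) (N : Necklace ω ℓ lam s x) (a₁ i₁ j₁ : ℕ) (p₁ p₂ : Site 2) (Arm Node : Set (Site 2)), a₁ < N.k → i₁ ≤ N.k → j₁ + 1 ≤ N.k → PathIn (openGraph ω) (zBall x (2 * s)) (N.u i₁) p₁ → PathIn (openGraph ω) (zBall x (2 * s)) (N.u (j₁ + 1)) p₂ → ((N.bigIdx a₁ = i₁ ∨ N.bigIdx a₁ = j₁ + 1) → Disjoint Arm Node) → (¬ PathIn (openGraph ω) (zBall x (2 * s)) (N.p a₁) p₁ ∧ ¬ PathIn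 (openGraph ω) (zBall x (2 * s)) (N.p a₁) p₂) ∨ Disjoint Arm Node :=
  fun _ _ _ _ _ N _ _ _ _ _ _ _ ha₁ hi₁ hj₁ hp₁ hp₂ hfree ↦ N.arm_havoid ha₁ hi₁ hj₁ hp₁ hp₂ hfree

end Summit.CriticalPhenomena.CardyFormulaZ2.Cruxes.NestingRigidity.PinchResampling

end
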